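import Summits.QuantumFields.BalabanUV.Beta.CompositeCorrectorDress
import Summits.QuantumFields.BalabanUV.Beta.CompositeCorrectorFormsGeneric
import Summits.QuantumFields.BalabanUV.Beta.CompositeCorrectorSlotSym

/-!
# `BalabanUV.Beta.CompositeCorrectorDressSym` — binder row D1 ∕ (C1), K-U3d-sym (L-k5): **THE (0.4)-COMPOSITE DRESSING FUNCTOR AND ITS TYPED ONE-SHOT KERNEL** — K-U3d F6e
# `CompositeCorrectorDress` (an2) re-typed at `psiKSym`: `cPsiS` (the decay constant at every rate), `dressPsiSAt` (the corrector dressing of a jet datum), `compChartS r L m s N :=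
# Ψ̂ˢ_m ∘ coDressKBmAt (toSite s) N KInv ∘ Ψ̂ˢ_mᵀ` (the (0.4)-composite one-shot chart at general `d`, `N`), `pullJS hs J := dressBmAt hs (dressPsiSAt J)` and **`TOf_pullJS`** — the one-shot
# kernel of the pulled-back jets IS the Hessian kernel of the composite chart against the transported stencils (the PULL letter of the all-(0.4) END, a THEOREM over `CompositeCorrectorSlotSym`).

WHAT ([our object] four `def`s `cPsiS`, `dressPsiSAt`, `compChartS`, `pullJS`; [folklore] the lemmas; nothing cited; 0 sorry).  (II) CONTROL: the ROOTED engine is the tree's F6e `TOf_pullJ`.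

HONEST FRAMING (cell charter, verbatim): «discharging BetaPertH makes Balaban's UV stability UNCONDITIONAL — a real
constructive-QFT result; it is NOT the continuum limit and NOT the Clay problem.»
HONEST DEPENDENCY: continuum YM on T⁴ ⇐ BetaPertH ∧ nine spine estimates (0/9 proved); BetaPertH ⇐ (D1) ∧ (D4) ∧ CAP+tail;
G-an2-4 gates asym, D1 and NE2/3/4.
ABSOLUTE RULE (cell, verbatim): «No internally-minted statement may enter as a cited fact. Every hypothesis is either kernel-proved in this
package or a verbatim quotation of a PUBLISHED theorem with page reference. The manuscript(s) under audit are NOT citable for their own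
disputed steps — they are the thing under adjudication; programme-internal (2001/route/tribunal) claims are never citable.»
Row D1 ∕ (C1) OWNER an2 (b2b-balaban-beta-an2) gen 92, 2026-08-31.  No existing file touched.  STAGED ONLY (FILING PLAN FP-L F-L6); NOT proposed before the operator∕director line.
NOTHING of Bałaban's asserted, valued or discharged; 0 estimates; 0∕4 row-D1 binders; ROOT M‴ p325680 ∕ P5c ∕ D6 untouched; NOT (C1), NOT (T-ID), NOT D1, NEVER «G-an2-4 closed», NOT BetaPertH, NOT continuum, NOT Clay.
-/


noncomputable section

namespace Summit.QuantumFields.BalabanUV.Beta.CompositeCorrectorDressSym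

open Finset
open scoped BigOperators
open Literature.MathematicalPhysics.QuantumFieldTheory
open Literature.MathematicalPhysics.QuantumFieldTheory.Balaban1983to89
open Literature.MathematicalPhysics.QuantumFieldTheory.Balaban1983to89.Beta
open B12Sec2to5 (l1 l1_nonneg)
open ExpKernelCalculus (MKer Decays BiLoc comp hessKer VertexFamily VertexFamily₂ Zl biLoc_comp_decays)
open AffineAveraging (Site box toSite)
open OneStepResolventKernel (Fib KInv wsum LocStencil JetData TOf decays_KInv biLoc_mono decays_mono)
open OneStepKernelFamily (colH vertexOfK vertexOfK_KInv vertexFamily_vertexOfK')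
open Summit.QuantumFields.BalabanUV.Beta.TameKernelCalculus (Spr Loc trK Spr.tame Loc.tame Spr.trK Spr.comp_loc Loc.comp_spr decays_trK slices_tame)
open Summit.QuantumFields.BalabanUV.Beta.ChartConjugationRelative (spr_comp)
open Summit.QuantumFields.BalabanUV.Beta.AxialDressingRooted (coDressKBmAt dressBmAt spr_coDressKBmAt decays_coDressKBmAt hessKer_dressBmAt one_le_of_neZero)
open Summit.QuantumFields.BalabanUV.Beta.CompositeCorrectorKernel (psiK kerBound)
open Summit.QuantumFields.BalabanUV.Beta.CompositeCorrectorDress (sandS sandW cSand locStencil_sandS vertexFamily₂_sandW hessKer_sand_of_adj compChart pullJ TOf_pullJ)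
open Summit.QuantumFields.BalabanUV.Beta.CompositeCorrectorKernelSym (psiKSym decays_psiKSym spr_psiKSym)
open Summit.QuantumFields.BalabanUV.Beta.CompositeCorrectorSlotSym (slotPsiSymF locStencil_slotPsiSymF vertexOfK_conj_psiKSym)

variable {d : ℕ}

/-! ## §3 The instance at the kernelised (0.4)-composite corrector `Ψ̂ˢ_m = psiKSym r L m` -/

section PsiS

/-- [our object — bookkeeping] the decay constant of `Ψ̂ˢ_m` at rate `δ` (XREAD-RS's `decays_psiKSym`: `kerBound Ψ̂ˢ_m (L^m) · e^{δ·2(d+1)L^m}`). -/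
def cPsiS (r : ℕ → (Fin (d + 1) → ℕ)) (L m : ℕ) (δ : ℝ) : ℝ :=
  kerBound (psiKSym r L m) (L ^ m) * Real.exp (δ * (2 * (((d : ℝ) + 1) * (L ^ m : ℕ))))

variable {L : ℕ} (hL : 0 < L) {r : ℕ → (Fin (d + 1) → ℕ)} (hr : ∀ k, r k ∈ box (d + 1) L) (m : ℕ)

include hL hr in
/-- [folklore] `Ψ̂ˢ_m` decays at every rate `δ ≥ 0` with constant `cPsiS r L m δ` (XREAD-RS's `decays_psiKSym` by name). -/
theorem decays_psiKSym_cPsiS {δ : ℝ} (hδ : 0 ≤ δ) : Decays (psiKSym r L m) (cPsiS r L m δ) δ :=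
  decays_psiKSym hL hr m hδ

include hL hr in
/-- [folklore] `0 ≤ cPsiS`. -/
theorem cPsiS_nonneg {δ : ℝ} (hδ : 0 ≤ δ) : 0 ≤ cPsiS r L m δ :=
  (decays_psiKSym_cPsiS hL hr m hδ).nonneg (Sum.inl 0)

include hL hr in
/-- [folklore] THE [S] SOCKET of the dressed stencil family: `sandS Ψ̂ˢ_m (slotPsiSymF r L m 𝒮)` is a local stencil family at rate `δ∕8` (XREAD-RL's `locStencil_slotPsiSymF` at rate
`δ∕2`, then `locStencil_sandS`). -/
theorem locStencil_dressPsiSS {S : Fin (d + 1) → Site (d + 1) → MKer (d + 1) (Fib d)} {Cs δ : ℝ} (hS : LocStencil S Cs δ) (hδ : 0 < δ) :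
    LocStencil (sandS (psiKSym r L m) (slotPsiSymF r L m S))
      (cSand d (cPsiS r L m (δ / 2)) (((d + 1 : ℕ) : ℝ) * (cPsiS r L m δ * Cs * Zl (d + 1) (δ / 2))) (δ / 2)) (δ / 8) := by
  have h1 : LocStencil (slotPsiSymF r L m S) (((d + 1 : ℕ) : ℝ) * (cPsiS r L m δ * Cs * Zl (d + 1) (δ / 2))) (δ / 2) :=
    locStencil_slotPsiSymF (decays_psiKSym_cPsiS hL hr m hδ.le) (cPsiS_nonneg hL hr m hδ.le) hS hδ
  have h2 := locStencil_sandS (decays_psiKSym_cPsiS hL hr m (half_pos hδ).le) (cPsiS_nonneg hL hr m (half_pos hδ).le) h1 (half_pos hδ)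
  rw [show δ / 2 / 4 = δ / 8 by ring] at h2
  exact h2

include hL hr in
/-- [folklore] THE [W] SOCKET of the dressed second-order family: `sandW Ψ̂ˢ_m 𝒲` is a second-order vertex family at rate `δ∕8`. -/
theorem vertexFamily₂_dressPsiSW {N : ℕ} {W : Fin (d + 1) → Site (d + 1) → Fin (d + 1) → Site (d + 1) → MKer (d + 1) (Fib d)} {Cw δ : ℝ}
    (hW : VertexFamily₂ W N Cw δ) (hδ : 0 < δ) :
    VertexFamily₂ (sandW (psiKSym r L m) W) N (cSand d (cPsiS r L m (δ / 2)) Cw (δ / 2)) (δ / 8) := by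
  have hCw : 0 ≤ Cw := (hW 0 0 0 0).nonneg (Sum.inl 0)
  have hW' : VertexFamily₂ W N Cw (δ / 2) := fun μ y ν y' => biLoc_mono (hW μ y ν y') hCw (by linarith)
  have h := vertexFamily₂_sandW (decays_psiKSym_cPsiS hL hr m (half_pos hδ).le) (cPsiS_nonneg hL hr m (half_pos hδ).le) hW' (half_pos hδ)
  rw [show δ / 2 / 4 = δ / 8 by ring] at h
  exact h

/-- [our object — bookkeeping] **THE `Ψ̂ˢ_m`-DRESSING FUNCTOR ON JET DATA**: the stencil family slot-transported by `Ψ̂ˢ_mᵀ` (XREAD-RL's `slotPsiF`) and leg-sandwiched,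
the second-order family leg-sandwiched; rate `δ∕8`; explicit constants. -/
def dressPsiSAt {N : ℕ} (J : JetData d N) : JetData d N where
  S := sandS (psiKSym r L m) (slotPsiSymF r L m J.S)
  W := sandW (psiKSym r L m) J.W
  Cs := cSand d (cPsiS r L m (J.δ / 2)) (((d + 1 : ℕ) : ℝ) * (cPsiS r L m J.δ * J.Cs * Zl (d + 1) (J.δ / 2))) (J.δ / 2)
  Cw := cSand d (cPsiS r L m (J.δ / 2)) J.Cw (J.δ / 2)
  δ := J.δ / 8
  δ_pos := by have := J.δ_pos; positivity
  loc := locStencil_dressPsiSS hL hr m J.loc J.δ_pos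
  loc₂ := vertexFamily₂_dressPsiSW hL hr m J.loc₂ J.δ_pos

/-- [folklore] the dressed stencil family, by definition. -/
theorem dressPsiSAt_S {N : ℕ} (J : JetData d N) (κ : Fin (d + 1)) (u : Site (d + 1)) :
    (dressPsiSAt hL hr m J).S κ u = comp (comp (trK (psiKSym r L m)) (slotPsiSymF r L m J.S κ u)) (psiKSym r L m) := rfl

/-- [folklore] the dressed second-order family, by definition. -/
theorem dressPsiSAt_W {N : ℕ} (J : JetData d N) (μ : Fin (d + 1)) (y : Site (d + 1)) (ν : Fin (d + 1)) (y' : Site (d + 1)) :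
    (dressPsiSAt hL hr m J).W μ y ν y' = comp (comp (trK (psiKSym r L m)) (J.W μ y ν y')) (psiKSym r L m) := rfl

/-- [folklore] the rate of the dressed datum. -/
theorem dressPsiSAt_δ {N : ℕ} (J : JetData d N) : (dressPsiSAt hL hr m J).δ = J.δ / 8 := rfl

include hL hr in
/-- [folklore] **THE `Ψ̂ˢ_m`-DRESSING LEMMA OVER AN ARBITRARY SPREAD KERNEL `K`**: for every jet datum `J`,
`hessKer K (vertexOfK K N (dressPsiSAt J).S) (dressPsiSAt J).W = hessKer (Ψ̂ˢ_m K Ψ̂ˢ_mᵀ) (vertexOfK (Ψ̂ˢ_m K Ψ̂ˢ_mᵀ) N J.S) J.W` — §2 at XREAD-RL's adjunction `vertexOfK_conj_psiK`. -/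
theorem hessKer_dressPsiSAt {N : ℕ} {K : MKer (d + 1) (Fib d)} (hK : Spr K) (J : JetData d N) (μ ν : Fin (d + 1)) (z : Site (d + 1)) :
    hessKer K (vertexOfK K N (dressPsiSAt hL hr m J).S) (dressPsiSAt hL hr m J).W μ ν z
      = hessKer (comp (comp (psiKSym r L m) K) (trK (psiKSym r L m))) (vertexOfK (comp (comp (psiKSym r L m) K) (trK (psiKSym r L m))) N J.S) J.W μ ν z := by
  have hΨ : Spr (psiKSym r L m) := spr_psiKSym hL hr m
  have h1 : LocStencil (slotPsiSymF r L m J.S) (((d + 1 : ℕ) : ℝ) * (cPsiS r L m J.δ * J.Cs * Zl (d + 1) (J.δ / 2))) (J.δ / 2) :=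
    locStencil_slotPsiSymF (decays_psiKSym_cPsiS hL hr m J.δ_pos.le) (cPsiS_nonneg hL hr m J.δ_pos.le) J.loc J.δ_pos
  have lW : ∀ μ' y' ν' y'', Loc (J.W μ' y' ν' y'') := fun μ' y' ν' y'' => ⟨_, _, J.Cw, J.δ, J.δ_pos, J.loc₂ μ' y' ν' y''⟩
  exact (hessKer_sand_of_adj hΨ hK h1 (half_pos J.δ_pos) (fun μ' y' => vertexOfK_conj_psiKSym hL hr m hK J.loc J.δ_pos μ' y') lW μ ν z).symm

end PsiS

/-! ## §4 With the block-mean dressing: the pulled-back jet datum and its typed one-shot kernel -/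

section PullS

/-- [our object — bookkeeping] **THE COMPOSITE ONE-SHOT CHART** (K-U3d's literal, `CompositeOneShotChart.spr_compositeA`'s term verbatim): `Ψ̂ˢ_m ∘ coDressKBmAt (toSite s) N KInv ∘ Ψ̂ˢ_mᵀ`
at blocking `N` with in-block big root `s`. -/
def compChartS (r : ℕ → (Fin (d + 1) → ℕ)) (L m : ℕ) (s : Fin (d + 1) → ℕ) (N : ℕ) [NeZero N] : MKer (d + 1) (Fib d) :=
  comp (comp (psiKSym r L m) (coDressKBmAt (toSite s) N (KInv (N := N) (d := d)))) (trK (psiKSym r L m))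

variable {L : ℕ} (hL : 0 < L) {r : ℕ → (Fin (d + 1) → ℕ)} (hr : ∀ k, r k ∈ box (d + 1) L) (m : ℕ)

/-- [our object — bookkeeping] **THE PULLED-BACK JET DATUM**: block-mean dressing after `Ψ̂ˢ_m`-dressing — `pullJ hs J := dressBmAt hs (dressPsiSAt J)`. -/
def pullJS {N : ℕ} [NeZero N] {s : Fin (d + 1) → ℕ} (hs : s ∈ box (d + 1) N) (J : JetData d N) : JetData d N :=
  dressBmAt hs (dressPsiSAt hL hr m J)

/-- [folklore] `pullJS` unfolded (`rfl`). -/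
theorem pullJS_eq {N : ℕ} [NeZero N] {s : Fin (d + 1) → ℕ} (hs : s ∈ box (d + 1) N) (J : JetData d N) :
    pullJS hL hr m hs J = dressBmAt hs (dressPsiSAt hL hr m J) := rfl

include hL hr in
/-- [folklore] **BOTH DRESSINGS OVER AN ARBITRARY DECAYING KERNEL `K`**:
`hessKer K (vertexOfK K N (pullJS hs J).S) (pullJS hs J).W = hessKer A (vertexOfK A N J.S) J.W`, `A := Ψ̂ˢ_m ∘ coDressKBmAt (toSite s) N K ∘ Ψ̂ˢ_mᵀ` — (B2) then §3. -/
theorem hessKer_dressBmAt_dressPsiSAt {N : ℕ} [NeZero N] {s : Fin (d + 1) → ℕ} (hs : s ∈ box (d + 1) N) {K : MKer (d + 1) (Fib d)}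
    (hK : ∃ δ C : ℝ, 0 < δ ∧ 0 ≤ C ∧ Decays K C δ) (J : JetData d N) (μ ν : Fin (d + 1)) (z : Site (d + 1)) :
    hessKer K (vertexOfK K N (dressBmAt hs (dressPsiSAt hL hr m J)).S) (dressBmAt hs (dressPsiSAt hL hr m J)).W μ ν z
      = hessKer (comp (comp (psiKSym r L m) (coDressKBmAt (toSite s) N K)) (trK (psiKSym r L m)))
          (vertexOfK (comp (comp (psiKSym r L m) (coDressKBmAt (toSite s) N K)) (trK (psiKSym r L m))) N J.S) J.W μ ν z := by
  have hN : 1 ≤ N := one_le_of_neZero N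
  have sK : Spr K := by
    obtain ⟨δ, C, hδ, -, h⟩ := hK
    exact ⟨C, δ, hδ, h⟩
  rw [hessKer_dressBmAt hs hK (dressPsiSAt hL hr m J)]
  exact hessKer_dressPsiSAt hL hr m (spr_coDressKBmAt hN hs sK) J μ ν z

include hL hr in
/-- [folklore] **THE TYPED ONE-SHOT KERNEL OF THE PULLED-BACK DATUM IS THE COMPOSITE SYSTEM's ONE-LOOP KERNEL IN ITS OWN CHART**:
`TOf (pullJS hs J) = hessKer (compChartS r L m s N) (vertexOfK (compChartS r L m s N) N J.S) J.W` — the (D-b) engine of (L2′) `hN`. -/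
theorem TOf_pullJS {N : ℕ} [NeZero N] {s : Fin (d + 1) → ℕ} (hs : s ∈ box (d + 1) N) (J : JetData d N) :
    TOf (N := N) (pullJS hL hr m hs J) = hessKer (compChartS r L m s N) (vertexOfK (compChartS r L m s N) N J.S) J.W := by
  funext μ ν z
  have eV : OneStepResolventKernel.vertexOf (N := N) (pullJS hL hr m hs J).S = vertexOfK (KInv (N := N)) N (pullJS hL hr m hs J).S :=
    funext fun μ' => funext fun y' => (vertexOfK_KInv (N := N) _ μ' y').symm
  unfold TOf
  rw [eV]
  exact hessKer_dressBmAt_dressPsiSAt hL hr m hs (decays_KInv (N := N) (d := d)) J μ ν z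

end PullS


/-! ## §5 (II) CONTROL: the ROOTED engine is the tree's F6e `CompositeCorrectorDress.TOf_pullJ` -/

section Control

variable {L : ℕ} (hL : 0 < L) {r : ℕ → (Fin (d + 1) → ℕ)} (hr : ∀ k, r k ∈ box (d + 1) L) (m : ℕ)

example {N : ℕ} [NeZero N] {s : Fin (d + 1) → ℕ} (hs : s ∈ box (d + 1) N) (J : JetData d N) :
    TOf (N := N) (pullJ hL hr m hs J) = hessKer (compChart r L m s N) (vertexOfK (compChart r L m s N) N J.S) J.W :=
  TOf_pullJ hL hr m hs J

end Control

end Summit.QuantumFields.BalabanUV.Beta.CompositeCorrectorDressSym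

end
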